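import Summits.AnomalousDissipation.AnomalousDissipation.Theorems.SawtoothPulseCascadeK1LocalisedCascadeFibreDerivExplicit

/-!
# K1loc, line `Spectral` / SeqCone — helper: THE SYMBOL-SOCKET CONSTANTS, EXPLICIT IN `sup|sT′|` (S-B constants, (g3))

Helper file of the prover lane on the crux `K1LocalisedCascade` (stmt-AnomalousDissipation-19491), route
`SawtoothPulseCascade` (glue seat k1loc-p3).  With the factor bounds of `…FibreDerivExplicit` the socket constants of
`…ConcreteStepH[Moments]` / `…ConcreteStepV` become explicit multiples of any bound `C₁` of `|sT′|`: `C_S = 2C₁`, `C_M = 6C₁`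
on H-fibres (`fibre_data_symProdS_H_of_bound`, `fibre_data_symProdM_H_sq_of_bound`), `C_M = 4C₁`, `C_S = 6C₁` on V-fibres
(`fibre_data_symProdM_V_of_bound`, `fibre_data_symProdS_V_sq_of_bound`) — literally the bodies of the `hSockS/hSockM`
hypotheses.  No definitions; no statement about the stub.  [cite: Grafakos2014, Prop. 3.1.2 (5)] [problem: turb]
-/

-- `Summit.<Summit>.<Problem>`: single-conjunct summit, the duplicate namespace segment is deliberate.
set_option linter.dupNamespace false

noncomputable section

namespace Summit.AnomalousDissipation.AnomalousDissipation.Theorems.SawtoothPulseCascade.K1Symbol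

open Set Filter Topology Real
open scoped ContDiff
open Summit.AnomalousDissipation.AnomalousDissipation.Theorems.SawtoothPulseCascade.K1Cutoff
open Summit.AnomalousDissipation.AnomalousDissipation.Theorems.SawtoothPulseCascade.K1Slot

/-! ## The four symbol sockets with constants explicit in `C₁` -/

/-- `C₁·(x/y) ≤ C₁/b` from `b·x ≤ y` (`b, y > 0`, `C₁ ≥ 0`). [folklore] -/
theorem mul_div_le_div_of_mul_le {C₁ x y b : ℝ} (hC₁ : 0 ≤ C₁) (hy : 0 < y) (hb : 0 < b) (h : b * x ≤ y) :
    C₁ * (x / y) ≤ C₁ / b := by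
  rw [show C₁ / b = C₁ * (1 / b) by ring]
  refine mul_le_mul_of_nonneg_left ?_ hC₁
  rw [div_le_div_iff₀ hy hb]; linarith

/-- **`hSockS` of the H plug with `C_S = 2C₁`**: first-order fibre data of `μ̂ = 1 − g^S_L·g^env_{R,w}` along H-fibres.
[cite: Grafakos2014, Prop. 3.1.2 (5)] -/
theorem fibre_data_symProdS_H_of_bound {C₁ : ℝ} (hC₁ : ∀ x, |deriv smoothTransition x| ≤ C₁) {γ ε εa a L R w b : ℝ}
    (hγ : 0 < γ) (hε : 0 < ε) (hεa : 0 < εa) (ha : 0 < a) (hL : 0 < L) (hR : 0 < R) (hw : 0 < w) (hb : 0 < b)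
    (hbγ : b * γ ≤ εa * L) (hbw : b ≤ w) (n : ℤ) :
    ContDiff ℝ 1 (fun t : ℝ => 1 - smoothTransition ((|(n : ℝ)| - L) / (ε * L)) *
        (1 - smoothTransition ((γ * |t| - a * |(n : ℝ)|) / (εa * L))) *
        ((1 - smoothTransition ((|(n : ℝ)| - R) / w)) * (1 - smoothTransition ((|t| - R) / w)))) ∧
    (∀ t : ℝ, |1 - smoothTransition ((|(n : ℝ)| - L) / (ε * L)) *
        (1 - smoothTransition ((γ * |t| - a * |(n : ℝ)|) / (εa * L))) *
        ((1 - smoothTransition ((|(n : ℝ)| - R) / w)) * (1 - smoothTransition ((|t| - R) / w)))| ≤ 1) ∧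
    ∀ t : ℝ, |deriv (fun t : ℝ => 1 - smoothTransition ((|(n : ℝ)| - L) / (ε * L)) *
        (1 - smoothTransition ((γ * |t| - a * |(n : ℝ)|) / (εa * L))) *
        ((1 - smoothTransition ((|(n : ℝ)| - R) / w)) * (1 - smoothTransition ((|t| - R) / w)))) t| ≤ 2 * C₁ / b := by
  have hC₁0 : 0 ≤ C₁ := (abs_nonneg _).trans (hC₁ 0)
  obtain ⟨C, -, hC⟩ := exists_fibre_data_symProdS_H
  obtain ⟨hcd, h1, -⟩ := hC hγ hε hεa ha hL hR hw hb hbγ hbw n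
  refine ⟨hcd, h1, fun t => ?_⟩
  obtain ⟨CS, -, hCS⟩ := exists_bound_deriv_coneFactorH
  obtain ⟨CE, -, hCE⟩ := exists_bound_deriv_envFactor
  have hdS := (hCS hγ hε hεa ha hL hb hbγ n t).1
  have hEt := (hCE hR hw hb hbw n 0 t).1
  simp only [sub_zero] at hEt
  have hS1 : |smoothTransition ((|(n : ℝ)| - L) / (ε * L)) * (1 - smoothTransition ((γ * |t| - a * |(n : ℝ)|) / (εa * L)))|
      ≤ 1 := by
    rw [abs_of_nonneg (coneFactorH_mem γ ε εa a L n t).1]; exact (coneFactorH_mem γ ε εa a L n t).2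
  have hE1 : |(1 - smoothTransition ((|(n : ℝ)| - R) / w)) * (1 - smoothTransition ((|t| - R) / w))| ≤ 1 := by
    have h := envFactor_mem R w n 0 t
    simp only [sub_zero] at h
    rw [abs_of_nonneg h.1]; exact h.2
  have hS' : |deriv (fun t : ℝ => smoothTransition ((|(n : ℝ)| - L) / (ε * L)) *
      (1 - smoothTransition ((γ * |t| - a * |(n : ℝ)|) / (εa * L)))) t| ≤ C₁ / b := by
    refine (abs_deriv_coneFactorH_le hC₁ hε hεa ha hL n t).trans ?_
    rw [abs_of_pos hγ]
    exact mul_div_le_div_of_mul_le hC₁0 (by positivity) hb hbγ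
  have hE' : |deriv (fun t : ℝ => (1 - smoothTransition ((|(n : ℝ)| - R) / w)) *
      (1 - smoothTransition ((|t| - R) / w))) t| ≤ C₁ / b := by
    have h := abs_deriv_envFactor_le hC₁ hR hw n 0 t
    simp only [sub_zero] at h
    refine h.trans (mul_div_le_div_of_mul_le hC₁0 hw hb (by linarith))
  rw [show 2 * C₁ / b = C₁ / b + C₁ / b by ring]
  exact abs_deriv_one_sub_mul_le hdS hEt hS1 hE1 hS' hE'

/-- **`hSockM` of the H plug with `C_M = 6C₁`**: first-order fibre data of the shifted squares of
`m̂ = 1 − g^M_{L₀}·g^env_{R,w}` along H-fibres. [cite: Grafakos2014, Prop. 3.1.2 (5)] -/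
theorem fibre_data_symProdM_H_sq_of_bound {C₁ : ℝ} (hC₁ : ∀ x, |deriv smoothTransition x| ≤ C₁)
    {γ ε εa a₂ L₀ R w b : ℝ} (hγ : 0 ≤ γ) (hε : 0 < ε) (hεa : 0 < εa) (ha₂ : 0 < a₂) (hL₀ : 0 < L₀) (hR : 0 < R)
    (hw : 0 < w) (hb : 0 < b) (hbγ : b * γ ≤ εa * L₀) (hbw : b ≤ w) (n : ℤ) (t₀ : ℝ) :
    ContDiff ℝ 1 (fun t : ℝ => (1 - smoothTransition ((|(n : ℝ)| - L₀) / (ε * L₀)) *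
        (1 - smoothTransition ((γ * |t - t₀ + γ * n| - a₂ * |(n : ℝ)|) / (εa * L₀)) *
          smoothTransition ((γ * |t - t₀ - γ * n| - a₂ * |(n : ℝ)|) / (εa * L₀))) *
        ((1 - smoothTransition ((|(n : ℝ)| - R) / w)) * (1 - smoothTransition ((|t - t₀| - R) / w)))) ^ 2) ∧
    (∀ t : ℝ, |(1 - smoothTransition ((|(n : ℝ)| - L₀) / (ε * L₀)) *
        (1 - smoothTransition ((γ * |t - t₀ + γ * n| - a₂ * |(n : ℝ)|) / (εa * L₀)) *
          smoothTransition ((γ * |t - t₀ - γ * n| - a₂ * |(n : ℝ)|) / (εa * L₀))) *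
        ((1 - smoothTransition ((|(n : ℝ)| - R) / w)) * (1 - smoothTransition ((|t - t₀| - R) / w)))) ^ 2| ≤ 1) ∧
    ∀ t : ℝ, |deriv (fun t : ℝ => (1 - smoothTransition ((|(n : ℝ)| - L₀) / (ε * L₀)) *
        (1 - smoothTransition ((γ * |t - t₀ + γ * n| - a₂ * |(n : ℝ)|) / (εa * L₀)) *
          smoothTransition ((γ * |t - t₀ - γ * n| - a₂ * |(n : ℝ)|) / (εa * L₀))) *
        ((1 - smoothTransition ((|(n : ℝ)| - R) / w)) * (1 - smoothTransition ((|t - t₀| - R) / w)))) ^ 2) t|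
      ≤ 6 * C₁ / b := by
  have hC₁0 : 0 ≤ C₁ := (abs_nonneg _).trans (hC₁ 0)
  obtain ⟨C, -, hC⟩ := exists_fibre_data_symProdM_H_sq
  obtain ⟨hcd, h1, -⟩ := hC hγ hε hεa ha₂ hL₀ hR hw hb hbγ hbw n t₀
  refine ⟨hcd, h1, fun t => ?_⟩
  obtain ⟨CM, -, hCM⟩ := exists_bound_deriv_midFactorH
  obtain ⟨CE, -, hCE⟩ := exists_bound_deriv_envFactor
  have e : (fun t : ℝ => smoothTransition ((|(n : ℝ)| - L₀) / (ε * L₀)) *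
      (1 - smoothTransition ((γ * |t - t₀ + γ * n| - a₂ * |(n : ℝ)|) / (εa * L₀)) *
        smoothTransition ((γ * |t - t₀ - γ * n| - a₂ * |(n : ℝ)|) / (εa * L₀)))) = fun t => 1 - (1 -
      smoothTransition ((|(n : ℝ)| - L₀) / (ε * L₀)) *
      (1 - smoothTransition ((γ * |t - t₀ + γ * n| - a₂ * |(n : ℝ)|) / (εa * L₀)) *
        smoothTransition ((γ * |t - t₀ - γ * n| - a₂ * |(n : ℝ)|) / (εa * L₀)))) := by
    funext t; ring
  have hMt := (hCM hγ hε hεa ha₂ hL₀ hb hbγ n t₀ t).1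
  rw [← e] at hMt
  have hEt := (hCE hR hw hb hbw n t₀ t).1
  have hM' : |deriv (fun t : ℝ => smoothTransition ((|(n : ℝ)| - L₀) / (ε * L₀)) *
      (1 - smoothTransition ((γ * |t - t₀ + γ * n| - a₂ * |(n : ℝ)|) / (εa * L₀)) *
        smoothTransition ((γ * |t - t₀ - γ * n| - a₂ * |(n : ℝ)|) / (εa * L₀)))) t| ≤ 2 * C₁ / b := by
    refine (abs_deriv_midFactorH_le hC₁ hε hεa ha₂ hL₀ n t₀ t).trans ?_
    rw [abs_of_nonneg hγ, show 2 * C₁ / b = (2 * C₁) / b by ring, show C₁ * (2 * γ / (εa * L₀)) =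
      (2 * C₁) * (γ / (εa * L₀)) by ring]
    exact mul_div_le_div_of_mul_le (by positivity) (by positivity) hb hbγ
  have hE' : |deriv (fun t : ℝ => (1 - smoothTransition ((|(n : ℝ)| - R) / w)) *
      (1 - smoothTransition ((|t - t₀| - R) / w))) t| ≤ C₁ / b :=
    (abs_deriv_envFactor_le hC₁ hR hw n t₀ t).trans (mul_div_le_div_of_mul_le hC₁0 hw hb (by linarith))
  rw [show 6 * C₁ / b = 2 * (2 * C₁ / b + C₁ / b) by ring]
  exact abs_deriv_one_sub_mul_sq_le hMt hEt (midFactorH_mem γ ε εa a₂ L₀ n t₀ t).1 (midFactorH_mem γ ε εa a₂ L₀ n t₀ t).2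
    (envFactor_mem R w n t₀ t).1 (envFactor_mem R w n t₀ t).2 hM' hE'

/-- **`hSockM` of the V plug with `C_M = 4C₁`**: first-order fibre data of `m̂ = 1 − g^M_{L₀}·g^env_{R,w}` along V-fibres.
[cite: Grafakos2014, Prop. 3.1.2 (5)] -/
theorem fibre_data_symProdM_V_of_bound {C₁ : ℝ} (hC₁ : ∀ x, |deriv smoothTransition x| ≤ C₁)
    {γ ε εa a₂ L₀ R w b : ℝ} (hε : 0 < ε) (hεa : 0 < εa) (ha₂ : 0 < a₂) (hL₀ : 0 < L₀) (hR : 0 < R) (hw : 0 < w)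
    (hb : 0 < b) (hb₁ : b ≤ ε * L₀) (hb₂ : b * (γ ^ 2 + a₂) ≤ εa * L₀) (hbw : b ≤ w) (n' : ℤ) :
    ContDiff ℝ 1 (fun t : ℝ => 1 - smoothTransition ((|t| - L₀) / (ε * L₀)) *
        (1 - smoothTransition ((γ * |(n' : ℝ) + γ * t| - a₂ * |t|) / (εa * L₀)) *
          smoothTransition ((γ * |(n' : ℝ) - γ * t| - a₂ * |t|) / (εa * L₀))) *
        ((1 - smoothTransition ((|t| - R) / w)) * (1 - smoothTransition ((|(n' : ℝ)| - R) / w)))) ∧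
    (∀ t : ℝ, |1 - smoothTransition ((|t| - L₀) / (ε * L₀)) *
        (1 - smoothTransition ((γ * |(n' : ℝ) + γ * t| - a₂ * |t|) / (εa * L₀)) *
          smoothTransition ((γ * |(n' : ℝ) - γ * t| - a₂ * |t|) / (εa * L₀))) *
        ((1 - smoothTransition ((|t| - R) / w)) * (1 - smoothTransition ((|(n' : ℝ)| - R) / w)))| ≤ 1) ∧
    ∀ t : ℝ, |deriv (fun t : ℝ => 1 - smoothTransition ((|t| - L₀) / (ε * L₀)) *
        (1 - smoothTransition ((γ * |(n' : ℝ) + γ * t| - a₂ * |t|) / (εa * L₀)) *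
          smoothTransition ((γ * |(n' : ℝ) - γ * t| - a₂ * |t|) / (εa * L₀))) *
        ((1 - smoothTransition ((|t| - R) / w)) * (1 - smoothTransition ((|(n' : ℝ)| - R) / w)))) t| ≤ 4 * C₁ / b := by
  have hC₁0 : 0 ≤ C₁ := (abs_nonneg _).trans (hC₁ 0)
  obtain ⟨C, -, hC⟩ := exists_fibre_data_symProdM_V
  obtain ⟨hcd, h1, -⟩ := hC (γ := γ) hε hεa ha₂ hL₀ hR hw hb hb₁ hb₂ hbw n'
  refine ⟨hcd, h1, fun t => ?_⟩
  obtain ⟨CM, -, hCM⟩ := exists_bound_deriv_midFactorV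
  obtain ⟨CE, -, hCE⟩ := exists_bound_deriv_envFactorV
  have hMt := (hCM (γ := γ) hε hεa ha₂ hL₀ hb hb₁ hb₂ n' t).1
  have hEt := (hCE hR hw hb hbw n' 0 t).1
  simp only [sub_zero] at hEt
  have hEm := envFactorV_mem R w n' 0 t
  simp only [sub_zero] at hEm
  have hM' : |deriv (fun t : ℝ => smoothTransition ((|t| - L₀) / (ε * L₀)) *
      (1 - smoothTransition ((γ * |(n' : ℝ) + γ * t| - a₂ * |t|) / (εa * L₀)) *
        smoothTransition ((γ * |(n' : ℝ) - γ * t| - a₂ * |t|) / (εa * L₀)))) t| ≤ 3 * C₁ / b := by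
    refine (abs_deriv_midFactorV_le hC₁ hε hεa ha₂ hL₀ n' t).trans ?_
    have h₁ : C₁ * (1 / (ε * L₀)) ≤ C₁ / b := mul_div_le_div_of_mul_le hC₁0 (by positivity) hb (by linarith)
    have h₂ : C₁ * ((γ ^ 2 + a₂) / (εa * L₀)) ≤ C₁ / b := mul_div_le_div_of_mul_le hC₁0 (by positivity) hb hb₂
    calc C₁ * (1 / (ε * L₀) + 2 * (γ ^ 2 + a₂) / (εa * L₀))
        = C₁ * (1 / (ε * L₀)) + 2 * (C₁ * ((γ ^ 2 + a₂) / (εa * L₀))) := by ring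
      _ ≤ C₁ / b + 2 * (C₁ / b) := by gcongr
      _ = 3 * C₁ / b := by ring
  have hE' : |deriv (fun t : ℝ => (1 - smoothTransition ((|t| - R) / w)) *
      (1 - smoothTransition ((|(n' : ℝ)| - R) / w))) t| ≤ C₁ / b := by
    have ecomm : (fun t : ℝ => (1 - smoothTransition ((|t| - R) / w)) * (1 - smoothTransition ((|(n' : ℝ)| - R) / w))) =
        fun t => (1 - smoothTransition ((|(n' : ℝ)| - R) / w)) * (1 - smoothTransition ((|t - 0| - R) / w)) := by
      funext t; rw [sub_zero]; ring
    rw [ecomm]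
    exact (abs_deriv_envFactor_le hC₁ hR hw n' 0 t).trans (mul_div_le_div_of_mul_le hC₁0 hw hb (by linarith))
  have hM1 : |smoothTransition ((|t| - L₀) / (ε * L₀)) *
      (1 - smoothTransition ((γ * |(n' : ℝ) + γ * t| - a₂ * |t|) / (εa * L₀)) *
        smoothTransition ((γ * |(n' : ℝ) - γ * t| - a₂ * |t|) / (εa * L₀)))| ≤ 1 := by
    rw [abs_of_nonneg (midFactorV_mem γ ε εa a₂ L₀ n' t).1]; exact (midFactorV_mem γ ε εa a₂ L₀ n' t).2
  have hE1 : |(1 - smoothTransition ((|t| - R) / w)) * (1 - smoothTransition ((|(n' : ℝ)| - R) / w))| ≤ 1 := by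
    rw [abs_of_nonneg hEm.1]; exact hEm.2
  rw [show 4 * C₁ / b = 3 * C₁ / b + C₁ / b by ring]
  exact abs_deriv_one_sub_mul_le hMt hEt hM1 hE1 hM' hE'

/-- **`hSockS` of the V plug with `C_S = 6C₁`**: first-order fibre data of the shifted squares of
`μ̂′ = 1 − g^S_{L}·g^env_{R,w}` along V-fibres. [cite: Grafakos2014, Prop. 3.1.2 (5)] -/
theorem fibre_data_symProdS_V_sq_of_bound {C₁ : ℝ} (hC₁ : ∀ x, |deriv smoothTransition x| ≤ C₁)
    {γ ε εa a L R w b : ℝ} (hε : 0 < ε) (hεa : 0 < εa) (ha : 0 < a) (hL : 0 < L) (hR : 0 < R) (hw : 0 < w) (hb : 0 < b)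
    (hb₁ : b ≤ ε * L) (hb₂ : b * a ≤ εa * L) (hbw : b ≤ w) (n' : ℤ) (t₀ : ℝ) :
    ContDiff ℝ 1 (fun t : ℝ => (1 - smoothTransition ((|t - t₀| - L) / (ε * L)) *
        (1 - smoothTransition ((γ * |(n' : ℝ)| - a * |t - t₀|) / (εa * L))) *
        ((1 - smoothTransition ((|t - t₀| - R) / w)) * (1 - smoothTransition ((|(n' : ℝ)| - R) / w)))) ^ 2) ∧
    (∀ t : ℝ, |(1 - smoothTransition ((|t - t₀| - L) / (ε * L)) *
        (1 - smoothTransition ((γ * |(n' : ℝ)| - a * |t - t₀|) / (εa * L))) *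
        ((1 - smoothTransition ((|t - t₀| - R) / w)) * (1 - smoothTransition ((|(n' : ℝ)| - R) / w)))) ^ 2| ≤ 1) ∧
    ∀ t : ℝ, |deriv (fun t : ℝ => (1 - smoothTransition ((|t - t₀| - L) / (ε * L)) *
        (1 - smoothTransition ((γ * |(n' : ℝ)| - a * |t - t₀|) / (εa * L))) *
        ((1 - smoothTransition ((|t - t₀| - R) / w)) * (1 - smoothTransition ((|(n' : ℝ)| - R) / w)))) ^ 2) t|
      ≤ 6 * C₁ / b := by
  have hC₁0 : 0 ≤ C₁ := (abs_nonneg _).trans (hC₁ 0)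
  obtain ⟨C, -, hC⟩ := exists_fibre_data_symProdS_V_sq
  obtain ⟨hcd, h1, -⟩ := hC (γ := γ) hε hεa ha hL hR hw hb hb₁ hb₂ hbw n' t₀
  refine ⟨hcd, h1, fun t => ?_⟩
  obtain ⟨CS, -, hCS⟩ := exists_bound_deriv_coneFactorV
  obtain ⟨CE, -, hCE⟩ := exists_bound_deriv_envFactorV
  have hSt := (hCS (γ := γ) hε hεa ha hL hb hb₁ hb₂ n' t₀ t).1
  have hEt := (hCE hR hw hb hbw n' t₀ t).1
  have hS' : |deriv (fun t : ℝ => smoothTransition ((|t - t₀| - L) / (ε * L)) *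
      (1 - smoothTransition ((γ * |(n' : ℝ)| - a * |t - t₀|) / (εa * L)))) t| ≤ 2 * C₁ / b := by
    refine (abs_deriv_coneFactorV_le hC₁ hε hεa ha hL n' t₀ t).trans ?_
    have h₁ : C₁ * (1 / (ε * L)) ≤ C₁ / b := mul_div_le_div_of_mul_le hC₁0 (by positivity) hb (by linarith)
    have h₂ : C₁ * (a / (εa * L)) ≤ C₁ / b := mul_div_le_div_of_mul_le hC₁0 (by positivity) hb hb₂
    calc C₁ * (1 / (ε * L) + a / (εa * L)) = C₁ * (1 / (ε * L)) + C₁ * (a / (εa * L)) := by ring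
      _ ≤ C₁ / b + C₁ / b := add_le_add h₁ h₂
      _ = 2 * C₁ / b := by ring
  have hE' : |deriv (fun t : ℝ => (1 - smoothTransition ((|t - t₀| - R) / w)) *
      (1 - smoothTransition ((|(n' : ℝ)| - R) / w))) t| ≤ C₁ / b := by
    have ecomm : (fun t : ℝ => (1 - smoothTransition ((|t - t₀| - R) / w)) * (1 - smoothTransition ((|(n' : ℝ)| - R) / w)))
        = fun t => (1 - smoothTransition ((|(n' : ℝ)| - R) / w)) * (1 - smoothTransition ((|t - t₀| - R) / w)) := by
      funext t; ring
    rw [ecomm]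
    exact (abs_deriv_envFactor_le hC₁ hR hw n' t₀ t).trans (mul_div_le_div_of_mul_le hC₁0 hw hb (by linarith))
  rw [show 6 * C₁ / b = 2 * (2 * C₁ / b + C₁ / b) by ring]
  exact abs_deriv_one_sub_mul_sq_le hSt hEt (coneFactorV_mem γ ε εa a L n' t₀ t).1 (coneFactorV_mem γ ε εa a L n' t₀ t).2
    (envFactorV_mem R w n' t₀ t).1 (envFactorV_mem R w n' t₀ t).2 hS' hE'

end Summit.AnomalousDissipation.AnomalousDissipation.Theorems.SawtoothPulseCascade.K1Symbol
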